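import Literature.NumberTheory.LFunctions.ZetaShiftRatioRH
import Literature.Analysis.SpecialFunctions.GammaShiftRatioSharp
import HarnessLib

/-!
# Balazard–de Roton 2010, Proposition 4 (i)–(ii): `ζ(s)/ζ(s+ε)` on the critical line under RH

Topic `Literature/NumberTheory/LFunctions`; a brick of the proof of Balazard–de Roton 2010,
Théorème 1 (`Literature.NumberTheory.LFunctions.BalazardDeRoton2010_thm1`, `NymanBeurlingRate.lean`).
M. Balazard, A. de Roton, *Sur un critère de Báez-Duarte pour l'hypothèse de Riemann*, Int. J.
Number Theory 6 (2010) 883–903 = arXiv:0812.1689, §3, Proposition 4 (HR), `σ = 1/2`,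
`0 < ε ≤ 1/2`:

  (i) `|ζ(s)/ζ(s+ε)|² ≪ |s|^ε`;   (ii) `|ζ(s)/ζ(s+ε)|² ≤ 1 + O(ε|s|^{1/2})`.

Both are proved here in PRODUCT form (no division; honest at zeros of the denominator, of which
there are none under RH) and for `0 ≤ ε ≤ 1/4` (the range used in the sequel; at `ε = 1/2`, `τ = 0`
the shifted point is the pole `s + ε = 1`, where Mathlib's `ζ` takes a junk value):

* `exists_norm_zeta_half_le_rpow_mul` — (i): `‖ζ(½+iτ)‖ ≤ C₁ (1+|τ|)^{ε/2} ‖ζ(½+ε+iτ)‖`;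
* `exists_norm_sq_zeta_half_le_one_add_mul` — (ii):
  `‖ζ(½+iτ)‖² ≤ (1 + C₂ ε (1+|τ|)^{1/2}) ‖ζ(½+ε+iτ)‖²`,

with absolute constants `C₁, C₂` (given RH). Printed proof (§3): the factorisation (t7)
`ζ(s)/ζ(s+ε) = π^{-ε/2} · (s+ε)(s+ε−1)/(s(s−1)) · Γ((s+ε)/2)/Γ(s/2) · ∏_ρ (s−ρ)/(s+ε−ρ)`, the
zero product having modulus `< 1` on `σ ≥ 1/2` under RH — here the master inequality
`BalazardDeRoton.norm_zeta_mul_le_of_RH` (`ZetaShiftRatioRH.lean`, from the tree's Hadamard product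
of `ξ`) —, (t8) `|(s+ε)(s+ε−1)/(s(s−1))| ≤ exp(O(ε/|s|))` (`norm_quad_shift_le`), Stirling (t10)
`|Γ((s+ε)/2)/Γ(s/2)| ≤ |s/2|^{ε/2}exp(O(ε/|s|))`
(`Literature.Analysis.SpecialFunctions.GammaShift.exists_norm_Gamma_add_le`), and the elementary
(t15) `x^{ε}e^{O(ε/x)} ≪ x^ε`, (t58) `x^{ε}e^{O(ε/x)} ≤ 1 + O(εx^{1/2})` (`rpow_le_one_add_mul`).
Proposition 4 (iii) (the half-plane version) is not needed in this form downstream and is not here.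

## References

* [BalazardDeRoton2010] M. Balazard, A. de Roton, Int. J. Number Theory 6 (2010) 883–903, §3,
  Prop. 4 and (t7)–(t58) (arXiv:0812.1689 pp. 3–4).
-/

noncomputable section

open Complex Filter Topology Real

namespace Literature.NumberTheory.LFunctions

namespace BalazardDeRoton

open Literature.Analysis.SpecialFunctions

/-! ## The point `s = 1/2 + iτ` -/

/-- `‖½ + iτ‖² = ¼ + τ²`. [folklore] -/
lemma norm_sq_half_add (τ : ℝ) : ‖(1 / 2 + τ * I : ℂ)‖ ^ 2 = 1 / 4 + τ ^ 2 := by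
  rw [Complex.sq_norm, Complex.normSq_apply]; simp; ring

/-- `‖(½ + iτ) − 1‖ = ‖½ + iτ‖`. [folklore] -/
lemma norm_half_add_sub_one (τ : ℝ) : ‖(1 / 2 + τ * I : ℂ) - 1‖ = ‖(1 / 2 + τ * I : ℂ)‖ := by
  have h1 : ‖(1 / 2 + τ * I : ℂ) - 1‖ ^ 2 = 1 / 4 + τ ^ 2 := by
    rw [Complex.sq_norm, Complex.normSq_apply]; simp; ring
  have h2 := norm_sq_half_add τ
  nlinarith [norm_nonneg ((1 / 2 + τ * I : ℂ) - 1), norm_nonneg (1 / 2 + τ * I : ℂ)]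

/-- `½ ≤ ‖½ + iτ‖`, `|τ| ≤ ‖½ + iτ‖` and `‖½ + iτ‖ ≤ ½ + |τ|`. [folklore] -/
lemma norm_half_add_bounds (τ : ℝ) :
    1 / 2 ≤ ‖(1 / 2 + τ * I : ℂ)‖ ∧ |τ| ≤ ‖(1 / 2 + τ * I : ℂ)‖ ∧
      ‖(1 / 2 + τ * I : ℂ)‖ ≤ 1 / 2 + |τ| := by
  have h := norm_sq_half_add τ
  have h0 := norm_nonneg (1 / 2 + τ * I : ℂ)
  have hτ := abs_nonneg τ
  have hτ2 : |τ| ^ 2 = τ ^ 2 := sq_abs τ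
  refine ⟨?_, ?_, ?_⟩
  · nlinarith
  · nlinarith
  · nlinarith

/-! ## (t8): the quadratic factor -/

/-- **(t8)** on `σ = 1/2`: `‖(s+ε)(s+ε−1)‖ ≤ ‖s(s−1)‖ (1 + ε/‖s‖)²` (`ε ≥ 0`), from
`|s+ε| ≤ |s| + ε`, `|s+ε−1| ≤ |s−1| + ε = |s| + ε`. [cite: BalazardDeRoton2010, §3 (t8)] -/
lemma norm_quad_shift_le (τ : ℝ) {ε : ℝ} (hε : 0 ≤ ε) :
    ‖((1 / 2 + τ * I : ℂ) + ε) * ((1 / 2 + τ * I : ℂ) + ε - 1)‖ ≤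
      ‖(1 / 2 + τ * I : ℂ) * ((1 / 2 + τ * I : ℂ) - 1)‖ * (1 + ε / ‖(1 / 2 + τ * I : ℂ)‖) ^ 2 := by
  set s : ℂ := 1 / 2 + τ * I with hs
  have hs0 : 0 < ‖s‖ := lt_of_lt_of_le one_half_pos (norm_half_add_bounds τ).1
  have hε' : ‖(ε : ℂ)‖ = ε := by rw [Complex.norm_real, Real.norm_eq_abs, abs_of_nonneg hε]
  have h1 : ‖s + ε‖ ≤ ‖s‖ * (1 + ε / ‖s‖) := by
    rw [mul_add, mul_one, mul_div_cancel₀ _ hs0.ne']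
    calc ‖s + ε‖ ≤ ‖s‖ + ‖(ε : ℂ)‖ := norm_add_le _ _
      _ = ‖s‖ + ε := by rw [hε']
  have h2 : ‖s + ε - 1‖ ≤ ‖s - 1‖ * (1 + ε / ‖s‖) := by
    rw [norm_half_add_sub_one, mul_add, mul_one, mul_div_cancel₀ _ hs0.ne']
    calc ‖s + ε - 1‖ = ‖(s - 1) + ε‖ := by ring_nf
      _ ≤ ‖s - 1‖ + ‖(ε : ℂ)‖ := norm_add_le _ _
      _ = ‖s‖ + ε := by rw [hε', norm_half_add_sub_one]
  rw [norm_mul, norm_mul]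
  calc ‖s + ε‖ * ‖s + ε - 1‖ ≤ (‖s‖ * (1 + ε / ‖s‖)) * (‖s - 1‖ * (1 + ε / ‖s‖)) :=
        mul_le_mul h1 h2 (norm_nonneg _) (by positivity)
    _ = ‖s‖ * ‖s - 1‖ * (1 + ε / ‖s‖) ^ 2 := by ring

/-! ## (t10): the `Γℝ` factor -/

/-- **(t10)** for `Γℝ(s) = π^{-s/2}Γ(s/2)` on `σ = 1/2`: there is an absolute `C ≥ 0` with
`‖Γℝ(s+ε)‖ ≤ ‖Γℝ(s)‖ · π^{-ε/2} ‖s/2‖^{ε/2} exp(Cε/(2+|τ|))` for `0 ≤ ε ≤ 1/2`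
(`Literature.Analysis.SpecialFunctions.GammaShift.exists_norm_Gamma_add_le` at `z = s/2`,
`h = ε/2`). [cite: BalazardDeRoton2010, §3 (t10)] -/
lemma exists_norm_Gammaℝ_shift_le : ∃ C : ℝ, 0 ≤ C ∧ ∀ τ ε : ℝ, 0 ≤ ε → ε ≤ 1 / 2 →
    ‖Gammaℝ ((1 / 2 + τ * I : ℂ) + ε)‖ ≤ ‖Gammaℝ (1 / 2 + τ * I : ℂ)‖ *
      (π ^ (-ε / 2) * ‖(1 / 2 + τ * I : ℂ) / 2‖ ^ (ε / 2) * Real.exp (C * ε / (2 + |τ|))) := by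
  obtain ⟨C, hC, hΓ⟩ := GammaShift.exists_norm_Gamma_add_le (x₀ := 1 / 4) (by norm_num) (by norm_num)
  refine ⟨C, hC, fun τ ε hε hε1 ↦ ?_⟩
  set s : ℂ := 1 / 2 + τ * I with hs
  set z : ℂ := s / 2 with hz
  have hzre : z.re = 1 / 4 := by simp [hz, hs]; norm_num
  have hzim : z.im = τ / 2 := by simp [hz, hs]
  have hkey := hΓ z (by rw [hzre]) (by rw [hzre]; norm_num) (ε / 2) (by linarith) (by linarith)
  -- unfold `Γℝ`
  have e1 : Gammaℝ (s + ε) = (π : ℂ) ^ (-(s + ε) / 2) * Gamma (z + ((ε / 2 : ℝ) : ℂ)) := by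
    rw [Gammaℝ_def]; congr 1; rw [hz]; push_cast; ring
  have e2 : Gammaℝ s = (π : ℂ) ^ (-s / 2) * Gamma z := by rw [Gammaℝ_def]
  have hn1 : ‖(π : ℂ) ^ (-(s + ε) / 2)‖ = π ^ (-(1 : ℝ) / 4) * π ^ (-ε / 2) := by
    rw [Complex.norm_cpow_eq_rpow_re_of_pos Real.pi_pos, ← Real.rpow_add Real.pi_pos]
    congr 1; simp [hs]; ring
  have hn2 : ‖(π : ℂ) ^ (-s / 2)‖ = π ^ (-(1 : ℝ) / 4) := by
    rw [Complex.norm_cpow_eq_rpow_re_of_pos Real.pi_pos]; congr 1; simp [hs]; norm_num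
  rw [e1, e2, norm_mul, norm_mul, hn1, hn2]
  have hexp : Real.exp (C * (ε / 2) / (1 + |z.im|)) = Real.exp (C * ε / (2 + |τ|)) := by
    congr 1; rw [hzim, abs_div, abs_two]; field_simp
  rw [hexp] at hkey
  have hπ0 : 0 ≤ π ^ (-(1 : ℝ) / 4) := Real.rpow_nonneg Real.pi_pos.le _
  have hπ1 : 0 ≤ π ^ (-ε / 2) := Real.rpow_nonneg Real.pi_pos.le _
  calc π ^ (-(1 : ℝ) / 4) * π ^ (-ε / 2) * ‖Gamma (z + ((ε / 2 : ℝ) : ℂ))‖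
      ≤ π ^ (-(1 : ℝ) / 4) * π ^ (-ε / 2) *
          (‖Gamma z‖ * ‖z‖ ^ (ε / 2) * Real.exp (C * ε / (2 + |τ|))) := by gcongr
    _ = π ^ (-(1 : ℝ) / 4) * ‖Gamma z‖ *
          (π ^ (-ε / 2) * ‖z‖ ^ (ε / 2) * Real.exp (C * ε / (2 + |τ|))) := by ring

/-! ## The ratio bound `‖ζ(s)‖ ≤ R(ε,τ) ‖ζ(s+ε)‖` -/

/-- **`‖ζ(½+iτ)‖ ≤ R(ε,τ) ‖ζ(½+ε+iτ)‖` under RH**, `0 ≤ ε ≤ 1/4`, with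
`R = (1+ε/|s|)² π^{-ε/2} |s/2|^{ε/2} exp(Cε/(2+|τ|))`: the master inequality
`‖ζ(s)‖‖s(s−1)‖‖Γℝ(s)‖ ≤ ‖ζ(s+ε)‖‖(s+ε)(s+ε−1)‖‖Γℝ(s+ε)‖` (Hadamard product, RH) combined
with (t8) and (t10). [cite: BalazardDeRoton2010, §3, Prop. 4 (proof)] -/
theorem exists_norm_zeta_half_le_ratio_mul (hRH : RiemannHypothesis) :
    ∃ C : ℝ, 0 ≤ C ∧ ∀ τ ε : ℝ, 0 ≤ ε → ε ≤ 1 / 4 →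
      ‖riemannZeta (1 / 2 + τ * I)‖ ≤
        ((1 + ε / ‖(1 / 2 + τ * I : ℂ)‖) ^ 2 * (π ^ (-ε / 2) *
          ‖(1 / 2 + τ * I : ℂ) / 2‖ ^ (ε / 2) * Real.exp (C * ε / (2 + |τ|)))) *
        ‖riemannZeta (1 / 2 + ε + τ * I)‖ := by
  obtain ⟨C, hC, hΓ⟩ := exists_norm_Gammaℝ_shift_le
  refine ⟨C, hC, fun τ ε hε hε1 ↦ ?_⟩
  set s : ℂ := 1 / 2 + τ * I with hs
  have hsre : s.re = 1 / 2 := by simp [hs]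
  have hs1 : s ≠ 1 := fun h ↦ by have := congrArg Complex.re h; rw [hsre] at this; norm_num at this
  have hs1' : s + ε ≠ 1 := fun h ↦ by
    have := congrArg Complex.re h; simp [hs] at this; linarith
  have hM := norm_zeta_mul_le_of_RH hRH (s := s) (by rw [hsre]) hs1 hε hs1'
  have hq := norm_quad_shift_le τ hε
  have hg := hΓ τ ε hε (by linarith)
  have hsε : s + ε = 1 / 2 + ε + τ * I := by rw [hs]; ring
  rw [← hsε]
  -- positivity of the cancelled factors
  have hs0 : 0 < ‖s‖ := lt_of_lt_of_le one_half_pos (norm_half_add_bounds τ).1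
  have hq0 : 0 < ‖s * (s - 1)‖ := by
    rw [norm_mul, norm_half_add_sub_one]; positivity
  have hG0 : 0 < ‖Gammaℝ s‖ := norm_pos_iff.mpr (Gammaℝ_ne_zero_of_re_pos (by rw [hsre]; norm_num))
  set R₁ : ℝ := (1 + ε / ‖s‖) ^ 2 with hR₁
  set R₂ : ℝ := π ^ (-ε / 2) * ‖s / 2‖ ^ (ε / 2) * Real.exp (C * ε / (2 + |τ|)) with hR₂
  have key : ‖riemannZeta s‖ * (‖s * (s - 1)‖ * ‖Gammaℝ s‖) ≤
      (R₁ * R₂ * ‖riemannZeta (s + ε)‖) * (‖s * (s - 1)‖ * ‖Gammaℝ s‖) := by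
    calc ‖riemannZeta s‖ * (‖s * (s - 1)‖ * ‖Gammaℝ s‖)
        = ‖riemannZeta s‖ * ‖s * (s - 1)‖ * ‖Gammaℝ s‖ := by ring
      _ ≤ ‖riemannZeta (s + ε)‖ * ‖(s + ε) * (s + ε - 1)‖ * ‖Gammaℝ (s + ε)‖ := hM
      _ ≤ ‖riemannZeta (s + ε)‖ * (‖s * (s - 1)‖ * R₁) * (‖Gammaℝ s‖ * R₂) := by gcongr
      _ = (R₁ * R₂ * ‖riemannZeta (s + ε)‖) * (‖s * (s - 1)‖ * ‖Gammaℝ s‖) := by ring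
  exact le_of_mul_le_mul_right key (mul_pos hq0 hG0)

/-! ## Elementary inequalities: (t15) and (t58) -/

/-- `exp x ≤ 1 + x·exp M` for `0 ≤ x ≤ M`. [folklore] -/
lemma exp_le_one_add_mul_exp {x M : ℝ} (hx : 0 ≤ x) (hxM : x ≤ M) :
    Real.exp x ≤ 1 + x * Real.exp M := by
  have h1 : (1 - x) * Real.exp x ≤ 1 := by
    have h := Real.one_sub_le_exp_neg x
    rw [Real.exp_neg] at h
    have hpos := Real.exp_pos x
    calc (1 - x) * Real.exp x ≤ (Real.exp x)⁻¹ * Real.exp x :=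
          mul_le_mul_of_nonneg_right h hpos.le
      _ = 1 := inv_mul_cancel₀ hpos.ne'
  have h2 : Real.exp x ≤ Real.exp M := Real.exp_le_exp.mpr hxM
  nlinarith [Real.exp_pos x]

/-- **(t58)**, the convexity step: for `0 ≤ a ≤ T`, `1 ≤ T` and `0 ≤ θ ≤ 1/2`,
`a^θ ≤ 1 + 2θ T^{1/2}` (`θ ↦ b^θ` is convex, `b = a^{1/2}`). [cite: BalazardDeRoton2010, §3 (t58)] -/
lemma rpow_le_one_add_mul {a T θ : ℝ} (ha : 0 ≤ a) (haT : a ≤ T) (hT : 1 ≤ T) (hθ : 0 ≤ θ)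
    (hθ1 : θ ≤ 1 / 2) : a ^ θ ≤ 1 + 2 * θ * T ^ (1 / 2 : ℝ) := by
  have hT0 : 0 ≤ T ^ (1 / 2 : ℝ) := Real.rpow_nonneg (by linarith) _
  rcases le_or_gt a 1 with ha1 | ha1
  · calc a ^ θ ≤ 1 := Real.rpow_le_one ha ha1 hθ
      _ ≤ 1 + 2 * θ * T ^ (1 / 2 : ℝ) := by nlinarith
  · have ha0 : 0 < a := by linarith
    set b : ℝ := a ^ (1 / 2 : ℝ) with hb
    have hb1 : 1 ≤ b := Real.one_le_rpow ha1.le (by norm_num)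
    have hb0 : 0 < b := by linarith
    have hbT : b ≤ T ^ (1 / 2 : ℝ) := Real.rpow_le_rpow ha haT (by norm_num)
    have hab : a ^ θ = b ^ (2 * θ) := by
      rw [hb, ← Real.rpow_mul ha]; congr 1; ring
    rw [hab, Real.rpow_def_of_pos hb0]
    -- convexity of `exp` between `0` and `log b`, weights `1 - 2θ`, `2θ`
    have hconv := convexOn_exp.2 (Set.mem_univ 0) (Set.mem_univ (Real.log b))
      (by linarith : 0 ≤ 1 - 2 * θ) (by linarith : 0 ≤ 2 * θ) (by ring)
    simp only [smul_eq_mul, mul_zero, zero_add, Real.exp_zero, mul_one] at hconv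
    rw [Real.exp_log hb0] at hconv
    calc Real.exp (Real.log b * (2 * θ)) = Real.exp (2 * θ * Real.log b) := by ring_nf
      _ ≤ 1 - 2 * θ + 2 * θ * b := hconv
      _ ≤ 1 + 2 * θ * T ^ (1 / 2 : ℝ) := by nlinarith

/-- `(1 + u)⁴ ≤ 1 + 15u` for `0 ≤ u ≤ 1`. [folklore] -/
lemma one_add_pow_four_le {u : ℝ} (hu : 0 ≤ u) (hu1 : u ≤ 1) : (1 + u) ^ 4 ≤ 1 + 15 * u := by
  nlinarith [pow_le_one₀ hu hu1 (n := 2), pow_le_one₀ hu hu1 (n := 3), sq_nonneg u,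
    mul_nonneg hu (sq_nonneg u)]

/-! ## Proposition 4 (i) and (ii) -/

/-- **Balazard–de Roton 2010, Proposition 4 (i)** (HR), product form on `σ = 1/2`:
there is `C₁` with `‖ζ(½+iτ)‖ ≤ C₁ (1+|τ|)^{ε/2} ‖ζ(½+ε+iτ)‖` for all real `τ` and
`0 ≤ ε ≤ 1/4` (printed: `|ζ(s)/ζ(s+ε)|² ≪ |s|^ε`). [cite: BalazardDeRoton2010, Prop. 4 (i)] -/
theorem exists_norm_zeta_half_le_rpow_mul (hRH : RiemannHypothesis) :
    ∃ C₁ : ℝ, 0 < C₁ ∧ ∀ τ ε : ℝ, 0 ≤ ε → ε ≤ 1 / 4 →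
      ‖riemannZeta (1 / 2 + τ * I)‖ ≤
        C₁ * (1 + |τ|) ^ (ε / 2) * ‖riemannZeta (1 / 2 + ε + τ * I)‖ := by
  obtain ⟨C, hC, h⟩ := exists_norm_zeta_half_le_ratio_mul hRH
  refine ⟨4 * Real.exp C, by positivity, fun τ ε hε hε1 ↦ (h τ ε hε hε1).trans ?_⟩
  obtain ⟨hs1, hs2, hs3⟩ := norm_half_add_bounds τ
  set n : ℝ := ‖(1 / 2 + τ * I : ℂ)‖ with hn
  refine mul_le_mul_of_nonneg_right ?_ (norm_nonneg _)
  have h1 : (1 + ε / n) ^ 2 ≤ 4 := by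
    have : ε / n ≤ 1 := by rw [div_le_one (by linarith)]; linarith
    have h0 : 0 ≤ ε / n := by positivity
    nlinarith
  have h2 : π ^ (-ε / 2) ≤ 1 :=
    Real.rpow_le_one_of_one_le_of_nonpos (by linarith [Real.pi_gt_three]) (by linarith)
  have h3 : ‖(1 / 2 + τ * I : ℂ) / 2‖ ^ (ε / 2) ≤ (1 + |τ|) ^ (ε / 2) := by
    refine Real.rpow_le_rpow (norm_nonneg _) ?_ (by linarith)
    rw [norm_div, Complex.norm_ofNat, ← hn]; linarith
  have h4 : Real.exp (C * ε / (2 + |τ|)) ≤ Real.exp C := by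
    rw [Real.exp_le_exp, div_le_iff₀ (by positivity)]
    nlinarith [abs_nonneg τ]
  have hpow0 : 0 ≤ (1 + |τ|) ^ (ε / 2) := Real.rpow_nonneg (by positivity) _
  calc (1 + ε / n) ^ 2 * (π ^ (-ε / 2) * ‖(1 / 2 + τ * I : ℂ) / 2‖ ^ (ε / 2) *
        Real.exp (C * ε / (2 + |τ|)))
      ≤ 4 * (1 * (1 + |τ|) ^ (ε / 2) * Real.exp C) := by
        gcongr
    _ = 4 * Real.exp C * (1 + |τ|) ^ (ε / 2) := by ring

/-- **Balazard–de Roton 2010, Proposition 4 (ii)** (HR), product form on `σ = 1/2`: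
there is `C₂` with `‖ζ(½+iτ)‖² ≤ (1 + C₂ ε (1+|τ|)^{1/2}) ‖ζ(½+ε+iτ)‖²` for all real `τ`
and `0 ≤ ε ≤ 1/4` (printed: `|ζ(s)/ζ(s+ε)|² ≤ 1 + O(ε|s|^{1/2})`; the constant `1` in front is
the point). [cite: BalazardDeRoton2010, Prop. 4 (ii)] -/
theorem exists_norm_sq_zeta_half_le_one_add_mul (hRH : RiemannHypothesis) :
    ∃ C₂ : ℝ, 0 < C₂ ∧ ∀ τ ε : ℝ, 0 ≤ ε → ε ≤ 1 / 4 →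
      ‖riemannZeta (1 / 2 + τ * I)‖ ^ 2 ≤
        (1 + C₂ * ε * (1 + |τ|) ^ (1 / 2 : ℝ)) * ‖riemannZeta (1 / 2 + ε + τ * I)‖ ^ 2 := by
  obtain ⟨C, hC, h⟩ := exists_norm_zeta_half_le_ratio_mul hRH
  -- `D` bounds the `τ`-free factors: `(1+ε/|s|)⁴ e^{2Cε/(2+|τ|)} ≤ (1 + 30ε)(1 + K ε) ≤ 1 + Dε`
  set K : ℝ := 2 * C * Real.exp (2 * C) with hK
  have hK0 : 0 ≤ K := by positivity
  set D : ℝ := 30 + K + 30 * K with hD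
  have hD0 : 0 ≤ D := by positivity
  refine ⟨D + 2 + D, by positivity, fun τ ε hε hε1 ↦ ?_⟩
  have hR := h τ ε hε hε1
  obtain ⟨hs1, hs2, hs3⟩ := norm_half_add_bounds τ
  set n : ℝ := ‖(1 / 2 + τ * I : ℂ)‖ with hn
  set T : ℝ := 1 + |τ| with hT
  have hT1 : 1 ≤ T := by simp [hT]
  have hT12 : 1 ≤ T ^ (1 / 2 : ℝ) := Real.one_le_rpow hT1 (by norm_num)
  set R : ℝ := (1 + ε / n) ^ 2 * (π ^ (-ε / 2) * ‖(1 / 2 + τ * I : ℂ) / 2‖ ^ (ε / 2) *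
    Real.exp (C * ε / (2 + |τ|))) with hRdef
  have hR0 : 0 ≤ R := by positivity
  -- square the ratio bound
  have hsq : ‖riemannZeta (1 / 2 + τ * I)‖ ^ 2 ≤
      R ^ 2 * ‖riemannZeta (1 / 2 + ε + τ * I)‖ ^ 2 := by
    rw [← mul_pow]; exact pow_le_pow_left₀ (norm_nonneg _) hR 2
  refine hsq.trans (mul_le_mul_of_nonneg_right ?_ (sq_nonneg _))
  -- the four factors of `R²`
  have hu0 : 0 ≤ ε / n := by positivity
  have hu1 : ε / n ≤ 2 * ε := by
    rw [div_le_iff₀ (by linarith)]; nlinarith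
  have f1 : ((1 + ε / n) ^ 2) ^ 2 ≤ 1 + 30 * ε := by
    rw [← pow_mul]
    refine (one_add_pow_four_le hu0 (by linarith)).trans ?_
    linarith
  have f2 : (π ^ (-ε / 2)) ^ 2 ≤ 1 := by
    have : π ^ (-ε / 2) ≤ 1 :=
      Real.rpow_le_one_of_one_le_of_nonpos (by linarith [Real.pi_gt_three]) (by linarith)
    exact pow_le_one₀ (Real.rpow_nonneg Real.pi_pos.le _) this
  have f3 : (‖(1 / 2 + τ * I : ℂ) / 2‖ ^ (ε / 2)) ^ 2 ≤ 1 + 2 * ε * T ^ (1 / 2 : ℝ) := by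
    rw [← Real.rpow_natCast, ← Real.rpow_mul (norm_nonneg _)]
    have e : ε / 2 * ((2 : ℕ) : ℝ) = ε := by push_cast; ring
    rw [e]
    have hle : ‖(1 / 2 + τ * I : ℂ) / 2‖ ≤ T := by
      rw [norm_div, Complex.norm_ofNat, ← hn]; simp only [hT]; linarith
    exact rpow_le_one_add_mul (norm_nonneg _) hle hT1 hε (by linarith)
  have f4 : (Real.exp (C * ε / (2 + |τ|))) ^ 2 ≤ 1 + K * ε := by
    rw [← Real.exp_nat_mul]
    push_cast
    have hx0 : 0 ≤ 2 * (C * ε / (2 + |τ|)) := by positivity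
    have hx1 : 2 * (C * ε / (2 + |τ|)) ≤ 2 * C * ε := by
      have h1 : C * ε / (2 + |τ|) ≤ C * ε :=
        div_le_self (by positivity) (by linarith [abs_nonneg τ])
      linarith
    have hx2 : 2 * C * ε ≤ 2 * C := by nlinarith
    calc Real.exp (2 * (C * ε / (2 + |τ|)))
        ≤ 1 + 2 * (C * ε / (2 + |τ|)) * Real.exp (2 * C) :=
          exp_le_one_add_mul_exp hx0 (hx1.trans hx2)
      _ ≤ 1 + 2 * C * ε * Real.exp (2 * C) := by gcongr
      _ = 1 + K * ε := by simp only [hK]; ring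
  -- combine
  have hε1' : ε ≤ 1 := by linarith
  have hKε : K * ε ≤ K := mul_le_of_le_one_right hK0 hε1'
  have g1 : (1 + 30 * ε) * (1 + K * ε) ≤ 1 + D * ε := by
    have h1 : 30 * ε * (K * ε) ≤ 30 * K * ε := by
      have : 30 * ε * (K * ε) = (30 * K * ε) * ε := by ring
      rw [this]
      exact mul_le_of_le_one_right (by positivity) hε1'
    have h2 : (1 + 30 * ε) * (1 + K * ε) = 1 + (30 + K) * ε + 30 * ε * (K * ε) := by ring
    have h3 : 1 + D * ε = 1 + (30 + K) * ε + 30 * K * ε := by simp only [hD]; ring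
    rw [h2, h3]
    linarith
  have hDε : D * ε ≤ D := mul_le_of_le_one_right hD0 hε1'
  have g2 : (1 + D * ε) * (1 + 2 * ε * T ^ (1 / 2 : ℝ)) ≤ 1 + (D + 2 + D) * ε * T ^ (1 / 2 : ℝ) := by
    have hDε0 : 0 ≤ D * ε := by positivity
    have hT0 : 0 ≤ T ^ (1 / 2 : ℝ) := by positivity
    have e1 : D * ε ≤ D * ε * T ^ (1 / 2 : ℝ) := le_mul_of_one_le_right hDε0 hT12
    have e2 : D * ε * (2 * ε * T ^ (1 / 2 : ℝ)) ≤ D * ε * T ^ (1 / 2 : ℝ) := by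
      have : 2 * ε ≤ 1 := by linarith
      calc D * ε * (2 * ε * T ^ (1 / 2 : ℝ)) = (2 * ε) * (D * ε * T ^ (1 / 2 : ℝ)) := by ring
        _ ≤ 1 * (D * ε * T ^ (1 / 2 : ℝ)) :=
            mul_le_mul_of_nonneg_right this (mul_nonneg hDε0 hT0)
        _ = D * ε * T ^ (1 / 2 : ℝ) := one_mul _
    have e3 : (1 + D * ε) * (1 + 2 * ε * T ^ (1 / 2 : ℝ)) =
        1 + D * ε + 2 * ε * T ^ (1 / 2 : ℝ) + D * ε * (2 * ε * T ^ (1 / 2 : ℝ)) := by ring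
    have e4 : 1 + (D + 2 + D) * ε * T ^ (1 / 2 : ℝ) =
        1 + D * ε * T ^ (1 / 2 : ℝ) + 2 * ε * T ^ (1 / 2 : ℝ) + D * ε * T ^ (1 / 2 : ℝ) := by ring
    rw [e3, e4]
    linarith
  calc R ^ 2 = ((1 + ε / n) ^ 2) ^ 2 * (π ^ (-ε / 2)) ^ 2 *
        (‖(1 / 2 + τ * I : ℂ) / 2‖ ^ (ε / 2)) ^ 2 * (Real.exp (C * ε / (2 + |τ|))) ^ 2 := by
        simp only [hRdef]; ring
    _ ≤ (1 + 30 * ε) * 1 * (1 + 2 * ε * T ^ (1 / 2 : ℝ)) * (1 + K * ε) := by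
        gcongr
    _ = ((1 + 30 * ε) * (1 + K * ε)) * (1 + 2 * ε * T ^ (1 / 2 : ℝ)) := by ring
    _ ≤ (1 + D * ε) * (1 + 2 * ε * T ^ (1 / 2 : ℝ)) :=
        mul_le_mul_of_nonneg_right g1 (by positivity)
    _ ≤ 1 + (D + 2 + D) * ε * T ^ (1 / 2 : ℝ) := g2

end BalazardDeRoton

end Literature.NumberTheory.LFunctions

end
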